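import Summits.QuantumFields.YangMills.Theorems.IR.Negative.TypOnsetFloorPoly.Twist
import Summits.QuantumFields.YangMills.Theorems.IR.Negative.HairpinStokes

/-!
# Crux `IR` (stmt-QuantumFields-19354) — the POLYNOMIAL ROW FLOOR `b⋆_T(β) ≥ c·(β / log β)^{1/7}` for EVERY compact gauge group,
# part 10/10 (headline): §5 Freeze_poly at exponent 1/4, R1d PROVED (hairpin Stokes), R1, K1‴…K1 and the assembled floor —
# `rowFloorPoly_seventh` ∕ `typFloor_seventh` KERNEL-COMPLETE (section `Stubs`)

Re-homed VERBATIM (statements, proofs, names; namespace `…Cruxes.IR.CruxIdea2g7` ↦ `…Cruxes.IR.RowFloorPoly`) from the crux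
workfile `Cruxes/IR/CruxIdea2RowFloorPoly.lean` rev 14 (sha16 742d7312ea0b5c70; author `ym-cruxidea-19354-2` GEN 7; kernel certificate
`Cruxes/IR/CruxIdea2RowFloorPolyCert.lean` rev 1, sha16 59d3cfe64fab9c7c, gate-elaborated stub-free) per owner R114 (2) (landing seat:
the `ym-19354-disprove-1` lineage, g9), split by its sections into ten ≤ 400-line modules chained by import; the module docstring of
record (history, theorem map, honest framing) is in the headline module `Theorems/IR/Negative/TypOnsetFloorPoly.lean` (part 10/10).
Negative knowledge for stmt-QuantumFields-19354 (`--supports`; closes no stub); not mixing, not a mass gap, nothing about Clay.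

AUTHOR'S MODULE DOCSTRING OF RECORD (rev 14, verbatim below the title line; the `sorry` it mentions is CLOSED in this module):

# Crux `IR` (stmt-QuantumFields-19354) — crux-ideate seat 2, GEN 7 (lens negation, REFINE-ONLY):
# the QUANTITATIVE SUCCESSOR of the all-`G` fixed-mesh negative — a POLYNOMIAL ROW FLOOR
# `b⋆_T(β) ≥ c · (β / log β)^{1/7}` reduced, sorry-free, to ONE typed concentration input — AND (rev 14) THAT INPUT PROVED
# in the companion workfile `CruxIdea2HairpinStokes.lean` rev 3: combined check rc 0, ZERO sorries ⇒ `rowFloorPoly_seventh` ∕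
# `typFloor_seventh` are kernel-complete; the one `sorry` kept in §5 is an import placeholder (see its docstring)
# (rev 2: Freeze PROVED at exponent 1/4; rev 3/4: ROUTE B — F reduced to an IN-MEAN bound on the PHYSICAL twist defect;
# rev 5–10: measurability, Stokes under the kernel, Cauchy–Schwarz/Jensen, Σ ⊆ touching, energy–entropy against a reference
# filling — rev 10: the μ-mean energy of one explicit configuration, R1; rev 11: R1 PROVED from the DETERMINISTIC weighted
# domination R1d — the ONE input is now a `β`-free, measure-free inequality for every configuration; rev 12: the filling IS the
# twisted configuration, plaquette cases and the top-face commutator bound PROVED — residual = hairpin Stokes + counting)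

Crux workfile of `ym-cruxidea-19354-2` GEN 7 (planner; count-neutral; scratch that elaborates — nothing here is a Theorems
statement and no registered stub is closed).  Namespace `Summit.QuantumFields.YangMills.Cruxes.IR.CruxIdea2g7`.
Imports ONLY landed modules: the headline `Theorems/IR/Negative/TypShellCondFalseAllG.lean` (ns `…Cruxes.IR.FixedMeshAllG`,
p525652 — this lineage's GEN 6 bytes re-homed by the `Negative/` lane, owner R88), `Theorems/IR/AfPincerUcFormat.lean` and
(rev 2) `Theorems/BalabanLadderIRAfOnsetPlaquetteMoments.lean` (S2 seat's volume-uniform plaquette moments from the chessboard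
estimate, `AfOnset.exists_plaquetteCost_moments_le`) and (rev 10) `Theorems/EquipartitionCriticalityFreeEnergyLogCoefficientStubExpChartPackage.lean`
(`FreeEnergyLogCoefficient.exists_haar_gball_ge`: the Haar small-ball lower bound `≥ C δ^{dimE ρ}`, Chatterjee Cor. 6.3).

## What GEN 6 left open and what this file types

GEN 6 proved, for EVERY compact `G`, faithful unitary `ρ`, `k₀ ≠ 1`, window `n`, `ε < 1`, admissible `δ`:
`∀ b ≥ 1, ∃ β₀(b), ∀ β ≥ β₀(b), ¬ TypShellCond ρ β b n ε δ` (`FixedMeshAllG.not_typShellCond_fixedMesh_allG'`), hence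
`b⋆_T(β) → ∞`; but `β₀(b)` is NOT tracked (both analytic inputs of `FixedMeshAllG.frame_core` — S2 `FixedMesh.torusLoopFreezing`
and INPUT F `frameValueBound_comb` via the SOFT `laplace_upper_uniform` — are `β → ∞` limits at FIXED mesh): NO RATE
(ctriage «B-before-β»; certideate-2 F2′; this seat's O-FTR-2).

THIS FILE (rev 12 = rev 10 + §4l + §4m: all `sorry`-free EXCEPT the ONE named stub of §5 — R1d `refAction_le_weighted` (a DETERMINISTIC,
`β`-FREE, MEASURE-FREE inequality: for every configuration `σ` the boundary Wilson action of the explicit reference configuration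
`refConfig b n k₀ σ` is dominated by a weighted sum of plaquette energies of `σ` with total weight `≤ C b⁵` — NO DLR kernel, NO Wilson
measure, NO `β` left in the stub); R1 `integral_refAction_le` (the `μ_{L_b,β}`-mean energy of the reference filling, `≤ C₁ b⁵ log β/β`) is
PROVED from R1d by §4l (`continuous_refConfig`, `AfOnset.exists_plaquetteCost_moments_le` per oriented plaquette, linearity);
K1‴ `integral_kernelAction_le` (the KERNEL-mean action, `≤ C b⁵ log β/β`) is PROVED from R1 and the region counts R3 by
§4j (energy–entropy against the reference filling: Lipschitz + product small balls + `ymSpecification_mean_action_le`), K1″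
`integral_kernelPlaqDefectSq_le` from K1‴ by §4i, K1′ `integral_kernelPlaqDefect_le` by §4h (Cauchy–Schwarz + Jensen), K1
`integral_twistDefect_le` from K1′ by §4g, K0 (measurability) in §4f):
* §1 `gibbsTail_le` ∕ `gibbsTail_le_exp_neg` (abstract energy–entropy tail for a tilted probability measure: `A ≤ s +
  (log(1/μ{A ≤ s}) + t)/β` off `ν_β`-mass `≤ e^{-t}`), `norm_list_prod_sub_one_le` (telescoping `‖∏ Vᵢ − 1‖ ≤ ∑ ‖Vᵢ − 1‖`);
* §2 `frame_core_at` — GEN 6's `frame_core` made POINTWISE in `(b, β)` (numeric hypotheses `hfreeze0`, `hFat` at this `(b, β)`);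
* §3 `polyRegime θ c β₀` (`β ≥ β₀ ∧ 1 ≤ b ≤ c (β/log β)^θ`), the Props `LoopFreezingPoly`, `FrameValuePoly` and the target
  `RowFloorPoly ρ n ε δ θ := ∃ c > 0, ∃ β₀, polyRegime θ c β₀ (¬ TypShellCond ρ · · n ε δ)`; §3b (rev 8) HYGIENE (O-FTR-4):
  `polyRegime_eventually_ge`, `fixedMesh_of_rowFloorPoly` (for `θ > 0` the floor implies the fixed-mesh negative; not vacuous);
* §4 `rowFloorPoly_of_inputs : LoopFreezingPoly ρ n θ → FrameValuePoly ρ n k₀ θ → RowFloorPoly ρ n ε δ θ` (`k₀ ≠ 1`, `ε < 1`,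
  admissible `δ`; via `frame_core_at` + the landed `topTwistTransfer_comb`), monotonicity in `θ`, `typFloor_of_rowFloorPoly` ∕
  `ukpcFloor_of_rowFloorPoly` (formats T and Uc);
* §4b–§4h (revs 2–7, PROVED; each section's docstring has the detail): §4b the DETERMINISTIC non-abelian Stokes inequality
  `one_sub_loopObs_le` and its annealed mean `one_sub_integral_loopObs_le` (⇒ Freeze 1/4); §4c `clip_re_trace_twisted_le`,
  `ymSpecification_tail_le`; §4d ROUTE B (`staple_topTwist`, `col_mul_staple_eq_twisted`, `twistedMeanObs_clip_le`,
  `frameValuePoly_of_kernelDefectPoly`); §4e `kernelDefectPoly_of_mean` (Markov + regime arithmetic, `c(η) = (η²/C)^{2/7}`); §4f K0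
  `measurable_twistDefect` (`integral_kernel_staple_boundary`); §4g Stokes under the kernel (`norm_col_mul_staple_sub_one_le`,
  `integral_twistDefect_le_of_kernelPlaqDefect`: K1 ⇐ K1′); §4h Cauchy–Schwarz + Jensen (`integral_sqrt_le_sqrt_integral`,
  `integral_kernelPlaqDefect_le_of_sq`: K1′ ⇐ K1″);
* §4i (rev 9, PROVED) `sigmaPlaq_mem_touching` (`Σ ⊆ plaquettesTouching Λ`), `plaqDefectSqSum_le_two_mul_action` (E1), `kernelAction`,
  `integral_kernelPlaqDefectSq_le_of_action` (K1″ ⇐ K1‴); energy–entropy MEAN bounds `gibbsMean_le` ∕ `ymSpecification_mean_action_le`;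
* §4j (rev 10, PROVED) ENERGY–ENTROPY AGAINST A REFERENCE FILLING: `wilsonBoundaryAction_le_of_ball` (Lipschitz of `A_Λ`, via
  `norm_map_plaquetteHolonomy_sub_le`), `pi_real_ball_ge`, `exists_haar_ball_center_ge` (small balls around ANY centre from the tree's
  `FreeEnergyLogCoefficient.exists_haar_gball_ge` + left invariance), `ymSpecification_mean_action_le_ref`, `kernelAction_le_ref`
  (`kernelAction V ≤ A_Λ(ζ₀ ∨ σ'_V) + K(ρ)(#Λ + #touching + 1) log β/β`, `β ≥ 3`), `integral_kernelAction_le_of_ref` (K1‴ ⇐ R1 ∧ R3);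
* §4k (rev 10, PROVED) R3 `rowRegion_counts` (`#Λ_b + #touching(Λ_b) + 1 ≤ C₀(n) b⁴`);
* §4l (rev 11, PROVED) `refFill` ∕ `refConfig` (the reference filling TYPED), `continuous_refConfig`, `plaquetteEnergy_torusLift`,
  `integral_refAction_le_of_weighted` (R1 ⇐ R1d);
* §4m (rev 12, PROVED) toward R1d: `refConfig_eq_twistΦ` (the reference filling IS `σ'`), `plaquetteHolonomyZd_topTwist_of_not_topFace` ∕
  `energy_topTwist_of_not_topFace`, `plaquetteHolonomyZd_topTwist_topFace` (top face: the conjugated `linkDefect` enters), `topFace_energy_le`,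
  `norm_linkDefect_comb_le` (comb defect = conjugate of the commutator `k₀⁻¹Wk₀W⁻¹` with the `hairpin` holonomy `W`: `≤ 2‖ρ W − 1‖`),
  `topFace_energy_comb_le` (`energy_p(σ') ≤ 4‖ρ W_p − 1‖² + 2φ_p(σ)`);
* §5 `loopFreezingPoly_quarter : LoopFreezingPoly ρ n (1/4)` (rev 2: PROVED from §4b), `frameValuePoly_seventh` (rev 3:
  PROVED by §4d), `kernelDefectPoly_seventh` (rev 4/5: PROVED by §4e + §4f), `integral_twistDefect_le` (K1; rev 6: PROVED by
  §4g), `integral_kernelPlaqDefect_le` (K1′; rev 7: PROVED by §4h), `integral_kernelPlaqDefectSq_le` (K1″; rev 9: PROVED by §4i)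
  `integral_kernelAction_le` (K1‴; rev 10: PROVED by §4j + §4k) and `integral_refAction_le` (R1; rev 11: PROVED by §4l) from the
  ONE remaining STUB R1d `refAction_le_weighted` (deterministic weighted domination; plan in its docstring), and the assembled
  `rowFloorPoly_seventh : RowFloorPoly ρ n ε δ (1/7)` ∕ `typFloor_seventh` (sorries: exactly the one stub).

HONEST FRAMING.  A typed REDUCTION, the annealed loop-freezing RATE (exponent `1/4`, proved) and abstract lemmas; the row-floor
rate `1/7` is a CLAIM OF THE PLAN until STUB R1d `refAction_le_weighted` closes (§5 docstring gives the bookkeeping), not a theorem.  Negative-side knowledge about clause (i) of formats T∕Uc at the ROW; it does NOT refute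
`stub_onsetUcSC` (whose witness mesh may grow like `ξ_lat(β) ∝ e^{c_G β} ≫ β^{1/7}`), says nothing about the mass gap, Clay,
or `Summit.QuantumFields`.  What it WOULD settle once §5 is proved: any proof of `stub_onsetUcSC` must produce meshes
`b(β) ≥ c (β / log β)^{1/7}` — the first power-of-`β` content of «B-before-β».
-/

set_option autoImplicit false

noncomputable section

open MeasureTheory Filter Topology
open Literature.MathematicalPhysics.QuantumLattice
open Literature.Probability.LatticeModels
open Summit.QuantumFields.YangMills.Cruxes.IR.Tempered (cellEdges windowCells regionEdges)
open Summit.QuantumFields.YangMills.Cruxes.IR.ShellTempered (windowCellsPlus)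
open Summit.QuantumFields.YangMills.Cruxes.IR.OnsetFormats (TypShellCond shellCount)
open Summit.QuantumFields.YangMills.Cruxes.IR.FixedMesh
open Summit.QuantumFields.YangMills.Cruxes.IR.FixedMeshAllG
open Summit.QuantumFields.YangMills.Theorems.FemtoCurvatureTwoPoint.DoublingOfRV (norm_rho_mul_sub_one_le norm_rho_inv_sub_one)
open Summit.QuantumFields.YangMills.Cruxes.IR.HairpinStokes (norm_map_conj_sub_one sub_re_trace_eq_norm_sq)
open Literature.MathematicalPhysics.QuantumFieldTheory (abs_re_trace_le_sqrt_mul re_trace_map_inv)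
open Summit.QuantumFields.YangMills.Theorems.FemtoCurvatureTwoPointC.TorusGauge.TwistLower (norm_rho_mul_sub_rho_mul_le norm_rho_inv_sub_rho_inv)

namespace Summit.QuantumFields.YangMills.Cruxes.IR.RowFloorPoly

/-! ## §5 Freeze_poly PROVED at exponent `1/4`; R1d PROVED (hairpin Stokes, `Theorems/IR/Negative/HairpinStokes`); R1, K1‴…K1 and the assembled floor `1/7` PROVED from it — kernel-complete -/

section Stubs

open Literature.MathematicalPhysics.QuantumFieldTheory (wilsonMeasure GaugeConfig isProbabilityMeasure_wilsonMeasure)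

variable {G : Type} [Group G] [TopologicalSpace G] [IsTopologicalGroup G] [CompactSpace G]
  [SecondCountableTopology G] [MeasurableSpace G] [BorelSpace G]
  {N : ℕ} (ρ : G →* Matrix (Fin N) (Fin N) ℂ)

/-- **Freeze_poly at exponent `1/4` — PROVED** (was STUB in rev 1).  From §4b: `1 − E_{L_b,β}[W ∘ lift] ≤
((b+1)(2n+1)b)²/N · K(1+log β)/β ≤ 8(2n+1)² K b⁴ log β/(Nβ)` (`β ≥ e`), which is `≤ η` whenever
`b ≤ c (β/log β)^{1/4}`, `c = min 1 (ηN / (8(2n+1)²(K+1)))`.  Inputs: the deterministic Stokes inequality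
`one_sub_loopObs_le` (this file) and the tree's `AfOnset.exists_plaquetteCost_moments_le` (chessboard ∕ FILS).  The exponent
`1/4` is what `area² × (energy per plaquette)` gives without using cancellations between plaquettes. -/
theorem loopFreezingPoly_quarter (hρ : Continuous ρ) (hρi : Function.Injective ρ)
    (hρu : ∀ g, ρ g ∈ Matrix.unitaryGroup (Fin N) ℂ) (hN : 1 ≤ N) (n : ℕ) :
    LoopFreezingPoly ρ n (1 / 4) := by
  intro η hη
  obtain ⟨K, hK0, hK⟩ := one_sub_integral_loopObs_le ρ hρ hρi hρu hN
  have hN0 : (0 : ℝ) < N := by exact_mod_cast hN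
  set D : ℝ := 8 * (2 * n + 1) ^ 2 * (K + 1) with hD
  have hD0 : 0 < D := by positivity
  set c : ℝ := min 1 (η * N / D) with hc
  have hc0 : 0 < c := lt_min one_pos (by positivity)
  have hc1 : c ≤ 1 := min_le_left _ _
  have hcD : c ≤ η * N / D := min_le_right _ _
  refine ⟨c, hc0, Real.exp 1, fun β hβ b hb hbc => ?_⟩
  have hβ1 : 1 ≤ β := (Real.one_lt_exp_iff.2 one_pos).le.trans hβ |>.trans' le_rfl
  have hβ0 : 0 < β := by linarith
  have hlog1 : 1 ≤ Real.log β := by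
    rw [← Real.log_exp 1]; exact Real.log_le_log (Real.exp_pos 1) hβ
  have hlog0 : 0 < Real.log β := by linarith
  set L : ℕ := (2 * n + 2) * b + 1 with hL
  have hL1 : 1 ≤ L := by omega
  have hmain := hK L hL1 β hβ1 hb ((2 * n + 1) * b)
  -- b⁴ ≤ c⁴ β / log β ≤ c β / log β
  have hx0 : 0 ≤ β / Real.log β := by positivity
  have hb4 : (b : ℝ) ^ 4 ≤ c * (β / Real.log β) := by
    have h1 : (b : ℝ) ^ 4 ≤ (c * (β / Real.log β) ^ (1 / 4 : ℝ)) ^ 4 :=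
      pow_le_pow_left₀ (by positivity) hbc 4
    have h2 : ((β / Real.log β) ^ (1 / 4 : ℝ)) ^ 4 = β / Real.log β := by
      rw [show (1 / 4 : ℝ) = ((4 : ℕ) : ℝ)⁻¹ by norm_num]
      exact Real.rpow_inv_natCast_pow hx0 (by norm_num)
    have h3 : c ^ 4 ≤ c := by
      calc c ^ 4 ≤ c ^ 1 := pow_le_pow_of_le_one hc0.le hc1 (by norm_num)
        _ = c := pow_one c
    calc (b : ℝ) ^ 4 ≤ c ^ 4 * (β / Real.log β) := by rw [mul_pow, h2] at h1; exact h1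
      _ ≤ c * (β / Real.log β) := by gcongr
  -- ((b+1)(2n+1)b)² ≤ 4(2n+1)² b⁴
  have hb1 : (1 : ℝ) ≤ b := by exact_mod_cast hb
  have hA : (((b + 1 : ℕ) : ℝ) * (((2 * n + 1) * b : ℕ) : ℝ)) ^ 2 ≤ 4 * (2 * n + 1) ^ 2 * (b : ℝ) ^ 4 := by
    push_cast
    have : ((b : ℝ) + 1) ≤ 2 * b := by linarith
    calc (((b : ℝ) + 1) * ((2 * n + 1) * b)) ^ 2 = ((b : ℝ) + 1) ^ 2 * ((2 * n + 1) * b) ^ 2 := by ring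
      _ ≤ (2 * (b : ℝ)) ^ 2 * ((2 * n + 1) * b) ^ 2 := by gcongr
      _ = 4 * (2 * n + 1) ^ 2 * (b : ℝ) ^ 4 := by ring
  -- assemble
  have hlogβ : (1 + Real.log β) / β ≤ 2 * Real.log β / β := by
    gcongr; linarith
  have hfinal : (((b + 1 : ℕ) : ℝ) * (((2 * n + 1) * b : ℕ) : ℝ)) ^ 2 / N * (K * (1 + Real.log β) / β) ≤ η := by
    calc (((b + 1 : ℕ) : ℝ) * (((2 * n + 1) * b : ℕ) : ℝ)) ^ 2 / N * (K * (1 + Real.log β) / β)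
        ≤ 4 * (2 * n + 1) ^ 2 * (c * (β / Real.log β)) / N * (K * (2 * Real.log β / β)) := by
          have hK1 : K * (1 + Real.log β) / β ≤ K * (2 * Real.log β / β) := by
            rw [mul_div_assoc]; exact mul_le_mul_of_nonneg_left hlogβ hK0
          gcongr
          exact hA.trans (by gcongr)
      _ = 8 * (2 * n + 1) ^ 2 * K * c / N := by
          field_simp
          ring
      _ ≤ D * c / N := by
          gcongr
          rw [hD]; nlinarith [sq_nonneg (2 * (n : ℝ) + 1), hK0]
      _ ≤ η := by
          rw [div_le_iff₀ hN0]
          calc D * c ≤ D * (η * N / D) := by gcongr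
            _ = η * N := by field_simp
  have hcast : ((b + 1 : ℕ) * ((2 * n + 1) * b : ℕ) : ℝ) = ((b + 1 : ℕ) : ℝ) * (((2 * n + 1) * b : ℕ) : ℝ) := by
    push_cast; ring
  linarith [hmain, hfinal]


omit [TopologicalSpace G] [IsTopologicalGroup G] [CompactSpace G] [SecondCountableTopology G]
    [MeasurableSpace G] [BorelSpace G] in
/-- **R1d — PROVED (kernel-complete after promotion).**  Closed below by `HairpinStokes.twistAction_le_weighted` (module
`Theorems/IR/Negative/HairpinStokes`, the author's companion workfile rev 3 re-homed) and `refConfig_eq_twistΦ` — exactly the 4-line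
splice of the kernel certificate `Cruxes/IR/CruxIdea2RowFloorPolyCert.lean` (sha16 59d3cfe64fab9c7c); the hypothesis `1 ≤ N` is kept
(statement verbatim) but unused.
(Author's plan, rev 11–13:) **STUB R1d — DETERMINISTIC WEIGHTED DOMINATION of the reference filling's boundary action (the ONE remaining input,
rev 11; R1 ⇐ R1d PROVED in §4l; the cases ∕ commutator half PROVED in §4m, rev 12).**  For every `b ≥ 1` there are nonnegative weights `w` on a finite set `P` of (oriented) `ℤ⁴`-plaquettes with
TOTAL WEIGHT `Σ_P w ≤ C b⁵` such that FOR EVERY configuration `σ` (no measure, no `β`):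
`A_Λ(refConfig σ) ≤ Σ_{q ∈ P} w_q · (N − Re tr ρ(σ_q))`.
PLAN (cases + one telescoping + Cauchy–Schwarz + counting): `refConfig σ` equals the gauge transform `h·σ`
(`h = layerGauge_b(comb σ)`) on every edge based at height `≠ b+1` (`gaugeTransformZd_layerGauge_apply`,
`topTwist_eq_gauge_on_rowLayer`) and `σ` on the site layer `b+1`, so every touching plaquette NOT in the top face has energy
`φ_p(σ)` exactly (weight `1`; `plaquetteHolonomyZd_gaugeTransformZd` + conjugation invariance of `Re tr`); a TOP-FACE plaquette
`p = (y,0,j)`, `y₀ = b`, reads the layer link through `k(x)⁻¹σ(x,j)k(x+e_j) = σ(x,j)·[Ad-defect of the HAIRPIN holonomy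
W(x,j) = stair(x)σ(x,j)stair(x+e_j)⁻¹ on k₀]` (`comb = stair⁻¹k₀stair`), `‖ρ(W) − 1‖_F ≤ Σ_{q ∈ hairpin(x,j)} ‖ρ(σ_q) − 1‖_F`
(`norm_list_prod_sub_one_le`, `≤ 4R` plaquettes, `R = (2n+2)b+1`), hence with `N − Re tr ρ U = ‖ρ U − 1‖²_F/2`
(`sub_re_trace_eq_norm_sq`) and Cauchy–Schwarz `energy_p(refConfig σ) ≤ 4(#hairpin + 1) Σ_{q ∈ hairpin ∪ {p}} φ_q(σ)`;
weights: `1` on the `≤ C(n)b⁴` touching plaquettes (§4k) plus `≤ 4(4R+1)·(multiplicity ≤ 2)` per (top-face link, hairpin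
plaquette) incidence, `≤ 3(4n+1)³b³ · (4R+1)` incidences: total `≤ C b⁵`.
RESIDUAL after §4m (which PROVES `refConfig σ = σ'`, the off-top-face invariance `energy_topTwist_of_not_topFace` and the top-face bound
`topFace_energy_comb_le : energy_p(σ') ≤ 4‖ρ(hairpin_p σ) − 1‖² + 2φ_p(σ)`): the HAIRPIN STOKES bound `‖ρ(hairpin b R σ y j) − 1‖_F ≤
Σ_{q ∈ H(y,j)} ‖ρ(σ_q) − 1‖_F` for some `H(y,j)` with `#H ≤ combLen R y 2 + combLen R y 3 ≤ 4R` (`y` in the layer, `InLayer b R y`; two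
staircase strips, cf. `mul_zline_eq_of_flatZd` for the flat case), then Cauchy–Schwarz (`(Σ_{H} a_q)² ≤ #H · Σ a_q²`, `a_q² = 2φ_q`) and the
count of top-face plaquettes touching `Λ` (`≤ #plaquettesTouching Λ ≤ C(n) b⁴` trivially; `≤ 3(4n+1)³b³` sharp).
Why it might fail: only bookkeeping.  Orientation conventions (`i < j` in `ZdPlaquette`) are absorbed by `Re tr ρ(U⁻¹) = Re tr ρ(U)`. -/
theorem refAction_le_weighted (hρu : ∀ g, ρ g ∈ Matrix.unitaryGroup (Fin N) ℂ) (_hN : 1 ≤ N) (n : ℕ) (k₀ : G) :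
    ∃ C : ℝ, 0 < C ∧ ∀ b : ℕ, 1 ≤ b → ∃ (P : Finset (ZdPlaquette 4)) (w : ZdPlaquette 4 → ℝ),
      (∀ q, 0 ≤ w q) ∧ ∑ q ∈ P, w q ≤ C * (b : ℝ) ^ 5 ∧
      ∀ σ : LGConfig 4 G, wilsonBoundaryAction ρ (rowRegion b n) (refConfig b n k₀ σ) ≤
        ∑ q ∈ P, w q * ((N : ℝ) - plaquetteObs ρ q.1 q.2.1.1 q.2.1.2 σ) := by
  obtain ⟨C, hC, h⟩ := HairpinStokes.twistAction_le_weighted ρ hρu n k₀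
  refine ⟨C, hC, fun b hb => ?_⟩
  obtain ⟨P, w, hw, hs, hd⟩ := h b hb
  exact ⟨P, w, hw, hs, fun σ => by rw [refConfig_eq_twistΦ]; exact hd σ⟩

/-- **R1 — the `μ`-MEAN ENERGY OF THE REFERENCE FILLING (PROVED from R1d by §4l, rev 11; was the rev-10 STUB).**  For `β ≥ 3`,
`b ≥ 1` the filling `ζ₀(V) = refFill b n k₀ (lift V)` of `Λ = rowRegion b n`, glued to the twisted datum `σ'_V = topTwist_b(comb_b k₀ σ) σ`
(`σ = lift V`; the glued configuration is `refConfig b n k₀ σ`), is measurable in `V` (`continuous_refConfig`) and has `μ_{L_b,β}`-mean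
boundary Wilson action `≤ C₁ b⁵ log β/β` (`integral_refAction_le_of_weighted`).  With R3 (`rowRegion_counts`, §4k) it gives K1‴
`integral_kernelAction_le` by `integral_kernelAction_le_of_ref` (§4j). -/
theorem integral_refAction_le (hρ : Continuous ρ) (hρi : Function.Injective ρ)
    (hρu : ∀ g, ρ g ∈ Matrix.unitaryGroup (Fin N) ℂ) (hN : 1 ≤ N) (n : ℕ) (k₀ : G) :
    ∃ C₁ : ℝ, 0 < C₁ ∧ ∃ β₂ : ℝ, ∀ β : ℝ, β₂ ≤ β → ∀ b : ℕ, 1 ≤ b →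
      ∃ ζ₀ : GaugeConfig 4 (2 * ((2 * n + 2) * b + 1) + 1) G → (↥(rowRegion b n) → G),
        Measurable (fun V => wilsonBoundaryAction ρ (rowRegion b n) (glueWith (rowRegion b n) (ζ₀ V)
          (twistΦ b (comb b ((2 * n + 2) * b + 1) k₀) (torusLift (2 * ((2 * n + 2) * b + 1) + 1) V)))) ∧
        ∫ V, wilsonBoundaryAction ρ (rowRegion b n) (glueWith (rowRegion b n) (ζ₀ V)
          (twistΦ b (comb b ((2 * n + 2) * b + 1) k₀) (torusLift (2 * ((2 * n + 2) * b + 1) + 1) V)))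
          ∂(wilsonMeasure (d := 4) (L := 2 * ((2 * n + 2) * b + 1) + 1) ρ β) ≤ C₁ * (b : ℝ) ^ 5 * (Real.log β / β) :=
  integral_refAction_le_of_weighted ρ hρ hρi hρu n k₀ (refAction_le_weighted ρ hρu hN n k₀)

/-- **K1‴ (PROVED from R1 + R3 by §4j, rev 10; was the rev-9 STUB)** — the in-mean BOUNDARY WILSON ACTION of `Λ = rowRegion b n`
under the twisted-boundary kernel: `E_{L_b,β} E_{γ_Λ(·|σ'_V)} wilsonBoundaryAction ρ Λ ≤ C b⁵ log β/β` for `β ≥ β₁`, `b ≥ 1`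
(`σ'_V = topTwist_b(comb_b k₀ σ) σ`, `σ = lift V`).  It implies (§4i, constant `2C`) K1″ `integral_kernelPlaqDefectSq_le`, then (§4h) K1′,
(§4g) K1, (§4e + §4f) `KernelDefectPoly ρ n k₀ (1/7)`.  Proof = `integral_kernelAction_le_of_ref` (energy–entropy against the reference
filling `refConfig`, §4j) + R1 `integral_refAction_le` (§4l ⇐ R1d) + R3 `rowRegion_counts` (§4k).  The rev-9 plan text (steps (a)–(e)) is
now realised by §4f–§4m; what remains of it is exactly the ONE stub R1d `refAction_le_weighted` (hairpin Stokes + counting). -/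
theorem integral_kernelAction_le (hρ : Continuous ρ) (hρi : Function.Injective ρ)
    (hρu : ∀ g, ρ g ∈ Matrix.unitaryGroup (Fin N) ℂ) (hN : 1 ≤ N) (n : ℕ) (k₀ : G) :
    ∃ C : ℝ, 0 < C ∧ ∃ β₁ : ℝ, ∀ β : ℝ, β₁ ≤ β → ∀ b : ℕ, 1 ≤ b →
      ∫ V, kernelAction ρ β b n k₀ V ∂(wilsonMeasure (d := 4) (L := 2 * ((2 * n + 2) * b + 1) + 1) ρ β) ≤
        C * (b : ℝ) ^ 5 * (Real.log β / β) :=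
  integral_kernelAction_le_of_ref ρ hρ hρi hρu (rowRegion_counts n) (integral_refAction_le ρ hρ hρi hρu hN n k₀)

/-- **K1″ (PROVED from K1‴ by §4i): the in-mean plaquette ENERGY of the film on `Σ` under the twisted-boundary kernel,**
`E_{L_b,β} E_{γ_Λ(·|σ')} Σ_{p∈Σ} ‖ρ(U_p) − 1‖²_F ≤ C b⁵ log β/β` (every plaquette of `Σ` touches `Λ`, so the energy on `Σ` is
`≤ 2 A_Λ`). -/
theorem integral_kernelPlaqDefectSq_le (hρ : Continuous ρ) (hρi : Function.Injective ρ)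
    (hρu : ∀ g, ρ g ∈ Matrix.unitaryGroup (Fin N) ℂ) (hN : 1 ≤ N) (n : ℕ) (k₀ : G) :
    ∃ C : ℝ, 0 < C ∧ ∃ β₁ : ℝ, ∀ β : ℝ, β₁ ≤ β → ∀ b : ℕ, 1 ≤ b →
      ∫ V, kernelPlaqDefectSq ρ β b n k₀ V ∂(wilsonMeasure (d := 4) (L := 2 * ((2 * n + 2) * b + 1) + 1) ρ β) ≤
        C * (b : ℝ) ^ 5 * (Real.log β / β) :=
  integral_kernelPlaqDefectSq_le_of_action ρ hρ hρu (integral_kernelAction_le ρ hρ hρi hρu hN n k₀)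

/-- **K1′ (PROVED from K1″ by §4h): the in-mean plaquette-DEFECT bound of the film under the twisted-boundary kernel,**
`E_{L_b,β} E_{γ_Λ(·|σ')} Σ_{p∈Σ} ‖ρ(U_p) − 1‖_F ≤ C b^{7/2} √(log β/β)`. -/
theorem integral_kernelPlaqDefect_le (hρ : Continuous ρ) (hρi : Function.Injective ρ)
    (hρu : ∀ g, ρ g ∈ Matrix.unitaryGroup (Fin N) ℂ) (hN : 1 ≤ N) (n : ℕ) (k₀ : G) :
    ∃ C : ℝ, 0 < C ∧ ∃ β₁ : ℝ, ∀ β : ℝ, β₁ ≤ β → ∀ b : ℕ, 1 ≤ b →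
      ∫ V, kernelPlaqDefect ρ β b n k₀ V ∂(wilsonMeasure (d := 4) (L := 2 * ((2 * n + 2) * b + 1) + 1) ρ β) ≤
        C * (b : ℝ) ^ (7 / 2 : ℝ) * Real.sqrt (Real.log β / β) :=
  integral_kernelPlaqDefect_le_of_sq ρ hρ hρu (integral_kernelPlaqDefectSq_le ρ hρ hρi hρu hN n k₀)

/-- **K1 (PROVED from K1′ by §4g, K1′ from K1″ by §4h): the in-mean twist-defect bound.** -/
theorem integral_twistDefect_le (hρ : Continuous ρ) (hρi : Function.Injective ρ)
    (hρu : ∀ g, ρ g ∈ Matrix.unitaryGroup (Fin N) ℂ) (hN : 1 ≤ N) (n : ℕ) (k₀ : G) :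
    ∃ C : ℝ, 0 < C ∧ ∃ β₁ : ℝ, ∀ β : ℝ, β₁ ≤ β → ∀ b : ℕ, 1 ≤ b →
      ∫ V, twistDefect ρ β b n k₀ V ∂(wilsonMeasure (d := 4) (L := 2 * ((2 * n + 2) * b + 1) + 1) ρ β) ≤
        C * (b : ℝ) ^ (7 / 2 : ℝ) * Real.sqrt (Real.log β / β) :=
  integral_twistDefect_le_of_kernelPlaqDefect ρ hρ hρu (integral_kernelPlaqDefect_le ρ hρ hρi hρu hN n k₀)

/-- **INPUT K_poly of exponent `1/7` (assembled from K1 `integral_twistDefect_le` by §4e, with K0 = §4f; K1 is PROVED down to the ONE stub R1d).** -/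
theorem kernelDefectPoly_seventh (hρ : Continuous ρ) (hρi : Function.Injective ρ)
    (hρu : ∀ g, ρ g ∈ Matrix.unitaryGroup (Fin N) ℂ) (hN : 1 ≤ N) (n : ℕ) (k₀ : G) :
    KernelDefectPoly ρ n k₀ (1 / 7) :=
  kernelDefectPoly_of_mean ρ hρ hρu (fun β b => measurable_twistDefect ρ hρ hρu β b n k₀)
    (integral_twistDefect_le ρ hρ hρi hρu hN n k₀)

/-- **INPUT F_poly of exponent `1/7` (PROVED from `kernelDefectPoly_seventh` by ROUTE B §4d; hence from the ONE stub R1d).** -/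
theorem frameValuePoly_seventh (hρ : Continuous ρ) (hρi : Function.Injective ρ)
    (hρu : ∀ g, ρ g ∈ Matrix.unitaryGroup (Fin N) ℂ) (hN : 1 ≤ N) (n : ℕ) {k₀ : G} (hk₀ : k₀ ≠ 1) :
    FrameValuePoly ρ n k₀ (1 / 7) :=
  frameValuePoly_of_kernelDefectPoly ρ hρ hρu hN (re_trace_div_lt_one ρ hρi hρu hN hk₀)
    (kernelDefectPoly_seventh ρ hρ hρi hρu hN n k₀)

/-- **THE POLYNOMIAL ROW FLOOR OF EXPONENT `1/7` (assembled; kernel-complete — R1d `refAction_le_weighted` is PROVED above).**  For every compact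
(second countable) `G`, continuous faithful unitary `ρ`, `N ≥ 1`, `k₀ ≠ 1`, window `n`, `ε < 1`, `0 ≤ δ`,
`4·#windowCellsPlus(n)·δ < 1`:  `∃ c > 0, ∃ β₀, ∀ β ≥ β₀, ∀ b, 1 ≤ b ≤ c (β / log β)^{1/7} → ¬ TypShellCond ρ β b n ε δ`. -/
theorem rowFloorPoly_seventh (hρ : Continuous ρ) (hρi : Function.Injective ρ)
    (hρu : ∀ g, ρ g ∈ Matrix.unitaryGroup (Fin N) ℂ) (hN : 1 ≤ N) {k₀ : G} (hk₀ : k₀ ≠ 1)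
    (n : ℕ) {ε δ : ℝ} (hε : ε < 1) (hδ0 : 0 ≤ δ) (hδ : 4 * ((windowCellsPlus n).card : ℝ) * δ < 1) :
    RowFloorPoly ρ n ε δ (1 / 7) :=
  rowFloorPoly_of_inputs ρ hρ hρi hρu hN hk₀ n hε hδ0 hδ
    (loopFreezingPoly_mono ρ (by norm_num) (loopFreezingPoly_quarter ρ hρ hρi hρu hN n))
    (frameValuePoly_seventh ρ hρ hρi hρu hN n hk₀)

/-- The floor in onset currency (assembled): for `[Nontrivial G]` nothing needs choosing. -/
theorem typFloor_seventh [Nontrivial G] (hρ : Continuous ρ) (hρi : Function.Injective ρ)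
    (hρu : ∀ g, ρ g ∈ Matrix.unitaryGroup (Fin N) ℂ) (hN : 1 ≤ N)
    (n : ℕ) {ε δ : ℝ} (hε : ε < 1) (hδ0 : 0 ≤ δ) (hδ : 4 * ((windowCellsPlus n).card : ℝ) * δ < 1) :
    ∃ c : ℝ, 0 < c ∧ ∃ β₀ : ℝ, ∀ β : ℝ, β₀ ≤ β → ∀ b : ℕ, 1 ≤ b → TypShellCond ρ β b n ε δ →
      c * (β / Real.log β) ^ (1 / 7 : ℝ) < b := by
  obtain ⟨k₀, hk₀⟩ := exists_ne (1 : G)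
  exact typFloor_of_rowFloorPoly ρ (rowFloorPoly_seventh ρ hρ hρi hρu hN hk₀ n hε hδ0 hδ)

end Stubs

end Summit.QuantumFields.YangMills.Cruxes.IR.RowFloorPoly

end
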